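import Mathlib
import Summits.ValiantsHypothesis.ValiantsHypothesis.Theorems.SymmetroidPencilBasics
import Summits.ValiantsHypothesis.ValiantsHypothesis.Theorems.LacunarySymmetroidMatrixDescartesStubPerturb
import Summits.ValiantsHypothesis.ValiantsHypothesis.Theorems.LacunarySymmetroidMatrixDescartesStubPerturbAssembly

/-!
# ValiantsHypothesis / LacunarySymmetroid — crux `MatrixDescartes` (stmt-ValiantsHypothesis-18050),
# line `Cruxes/MatrixDescartes/Lines/sign_split.lean`, stub `stub_perturb` (`PerturbToAlternation`,
# = `lorentzian_shadow`'s `stub_perturbT8`): PARTIAL LEMMAS — local splitting at ODD-multiplicity roots, and the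
# stub reduced to the EVEN-multiplicity local lemma

Helper file (`--supports stmt-ValiantsHypothesis-18050 --as helper`; cell val-lit, seat val-lit-p5 g9, merged desk
RULING #80).  Closes NO item and does NOT prove the stub; «V1 line stub; `MatrixDescartes` / Conjecture B /
`VP ≠ VNP` OPEN».

With `…StubPerturb` (sign calculus; odd roots are alternations) and `…StubPerturbAssembly` (global count from local
splitting) in the tree, this file supplies the local splitting lemma at roots of ODD multiplicity and packages the
honest residual of the stub:

* `exists_signChange_near_of_odd` — a root of odd multiplicity of a real polynomial `p ≠ 0` has, inside every
  neighbourhood, two points `a < ρ < b` with `p(a) p(b) < 0`;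
* `exists_eps_signChange_of_continuousAt` — a strict sign change of the `ε = 0` member of a family continuous in `ε`
  persists for all small `ε`;
* `sum_pow_smul_update`, `continuous_det_perturb`, `det_perturb_zero` — the perturbed pencils
  `S[l₀ ↦ S_{l₀} + (sε) E]` evaluated at a point: affine in `ε`, hence their determinants are continuous in `ε` and
  reduce to `det F_S` at `ε = 0`;
* **`localSplit_of_odd`** — local splitting at every positive root of ODD multiplicity of `det F_S`, for every
  symmetric (indeed every) `E`, every `l₀` and either sign;
* **`posRootCount_le_of_evenSplit`** — THE STUB'S CONCLUSION `posRootCount ≤ 2B` for a symmetric pencil `S` under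
  the stub's hypothesis, from the local splitting of the perturbed pencils at the positive roots of EVEN multiplicity
  ONLY (`E` symmetric, `K ≥ 1` through the parameter `l₀`).

RESIDUAL (NOT proved anywhere in the tree): the even-multiplicity local splitting lemma — for a generic `E ≻ 0`
and one sign `s`, `det (F_S(t) + sε t^{d_{l₀}} E)` changes sign near the root for all small `ε > 0` (parity of the
level crossings of the ordered spectrum of `E^{-1/2} F_S(t) E^{-1/2}`; `E = 1` fails on `F(t) = (t-1)·1₂`).  With it,
`posRootCount_le_of_evenSplit` yields `PerturbToAlternation` verbatim.
-/

set_option linter.dupNamespace false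

namespace Summit.ValiantsHypothesis.ValiantsHypothesis.Theorems.LacunarySymmetroidMatrixDescartes

open Polynomial Finset
open Summit.ValiantsHypothesis.ValiantsHypothesis.Theorems.SymmetroidDescartes (eval_det_pencil)

namespace Perturb

/-! ## 1. Odd-multiplicity roots of a real polynomial are strict sign changes, locally -/

/-- Inside every neighbourhood of a root `ρ` of ODD multiplicity of `p ≠ 0` there are `a < ρ < b` with
`p(a) p(b) < 0`. -/
theorem exists_signChange_near_of_odd (p : ℝ[X]) (hp : p ≠ 0) (ρ : ℝ) (hodd : Odd (p.rootMultiplicity ρ))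
    (δ : ℝ) (hδ : 0 < δ) :
    ∃ a b : ℝ, ρ - δ < a ∧ a < ρ ∧ ρ < b ∧ b < ρ + δ ∧ p.eval a * p.eval b < 0 := by
  classical
  -- a radius below δ and below the distance to every other root
  set R := p.roots.toFinset.erase ρ with hRdef
  obtain ⟨η, hηpos, hηδ, hηR⟩ : ∃ η : ℝ, 0 < η ∧ η < δ ∧ ∀ σ ∈ R, η < |σ - ρ| := by
    rcases R.eq_empty_or_nonempty with hR | hR
    · exact ⟨δ / 2, by linarith, by linarith, by simp [hR]⟩
    · have hne : (R.image fun σ => |σ - ρ|).Nonempty := hR.image _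
      set μ := (R.image fun σ => |σ - ρ|).min' hne with hμ
      have hμpos : 0 < μ := by
        obtain ⟨σ, hσ, hσeq⟩ := Finset.mem_image.mp (Finset.min'_mem _ hne)
        rw [hμ, ← hσeq]
        exact abs_pos.mpr (sub_ne_zero.mpr (Finset.ne_of_mem_erase hσ))
      refine ⟨min (δ / 2) (μ / 2), lt_min (by linarith) (by linarith), (min_le_left _ _).trans_lt (by linarith),
        fun σ hσ => ?_⟩
      have := Finset.min'_le _ _ (Finset.mem_image_of_mem (fun σ => |σ - ρ|) hσ)
      rw [← hμ] at this
      exact (min_le_right _ _).trans_lt (by linarith)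
  have hρroot : ρ ∈ p.roots.toFinset := by
    rw [Multiset.mem_toFinset, Polynomial.mem_roots hp]
    exact (Polynomial.rootMultiplicity_pos hp).mp hodd.pos
  -- no root other than ρ within distance η
  have hnear : ∀ σ ∈ p.roots.toFinset, |σ - ρ| ≤ η → σ = ρ := by
    intro σ hσ hle
    by_contra hne
    exact (not_lt.mpr hle) (hηR σ (Finset.mem_erase.mpr ⟨hne, hσ⟩))
  have hevne : ∀ x, |x - ρ| = η → p.eval x ≠ 0 := by
    intro x hx h
    have hxroot : x ∈ p.roots.toFinset := by
      rw [Multiset.mem_toFinset, Polynomial.mem_roots hp]; exact h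
    have := hnear x hxroot hx.le
    rw [this, sub_self, abs_zero] at hx
    exact hηpos.ne hx
  refine ⟨ρ - η, ρ + η, by linarith, by linarith, by linarith, by linarith, ?_⟩
  refine eval_mul_eval_neg_of_odd p hp _ _ (by linarith)
    (hevne _ (by rw [show ρ - η - ρ = -η by ring, abs_neg, abs_of_pos hηpos]))
    (hevne _ (by rw [show ρ + η - ρ = η by ring, abs_of_pos hηpos]))
    (countP_roots_odd_of_card_eq_one p _ _ ?_)
  rw [Finset.card_eq_one]
  refine ⟨ρ, Finset.eq_singleton_iff_unique_mem.mpr ⟨?_, fun σ hσ => ?_⟩⟩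
  · exact Finset.mem_filter.mpr ⟨Finset.mem_filter.mpr ⟨hρroot, by linarith, by linarith⟩, hodd⟩
  · obtain ⟨hσ1, -⟩ := Finset.mem_filter.mp hσ
    obtain ⟨hσroot, h1, h2⟩ := Finset.mem_filter.mp hσ1
    exact hnear σ hσroot (abs_sub_lt_iff.mpr ⟨by linarith, by linarith⟩).le

/-- A strict sign change of the `ε = 0` member of a family `g ε` continuous in `ε` at the two points persists for
all small `ε`. -/
theorem exists_eps_signChange_of_continuousAt (g : ℝ → ℝ → ℝ) (a b : ℝ)
    (ha : ContinuousAt (fun ε => g ε a) 0) (hb : ContinuousAt (fun ε => g ε b) 0) (h0 : g 0 a * g 0 b < 0) :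
    ∃ ε₀ : ℝ, 0 < ε₀ ∧ ∀ ε : ℝ, |ε| < ε₀ → g ε a * g ε b < 0 := by
  have hc : ContinuousAt (fun ε => g ε a * g ε b) 0 := ha.mul hb
  have hev : ∀ᶠ ε in nhds (0 : ℝ), g ε a * g ε b < 0 := hc.eventually_lt continuousAt_const h0
  obtain ⟨ε₀, hε₀, h⟩ := Metric.eventually_nhds_iff.mp hev
  exact ⟨ε₀, hε₀, fun ε hε => h (by simpa [Real.dist_eq] using hε)⟩

/-! ## 2. The perturbed pencils `S[l₀ ↦ S_{l₀} + c E]` at a point -/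

/-- Evaluating the perturbed pencil at a point: affine in the perturbation. -/
theorem sum_pow_smul_update {K m : ℕ} (d : Fin K → ℕ) (S : Fin K → Matrix (Fin m) (Fin m) ℝ)
    (l₀ : Fin K) (V : Matrix (Fin m) (Fin m) ℝ) (t : ℝ) :
    (∑ l, t ^ d l • Function.update S l₀ V l) = (∑ l, t ^ d l • S l) + t ^ d l₀ • (V - S l₀) := by
  have : ∀ l, t ^ d l • Function.update S l₀ V l =
      t ^ d l • S l + (if l = l₀ then t ^ d l₀ • (V - S l₀) else 0) := by
    intro l
    by_cases h : l = l₀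
    · subst h; simp [smul_sub]
    · simp [h]
  rw [Finset.sum_congr rfl fun l _ => this l, Finset.sum_add_distrib, Finset.sum_ite_eq' Finset.univ l₀]
  simp

/-- The determinant of the perturbed pencil at a fixed point is continuous in the size `c` of the perturbation. -/
theorem continuous_det_perturb {K m : ℕ} (d : Fin K → ℕ) (S : Fin K → Matrix (Fin m) (Fin m) ℝ)
    (l₀ : Fin K) (E : Matrix (Fin m) (Fin m) ℝ) (t : ℝ) :
    Continuous fun c : ℝ =>
      ((∑ l, (Polynomial.X : ℝ[X]) ^ d l •
        (Function.update S l₀ (S l₀ + c • E) l).map Polynomial.C).det).eval t := by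
  have hrw : ∀ c : ℝ, ((∑ l, (Polynomial.X : ℝ[X]) ^ d l •
      (Function.update S l₀ (S l₀ + c • E) l).map Polynomial.C).det).eval t =
        ((∑ l, t ^ d l • S l) + (t ^ d l₀ * c) • E).det := by
    intro c
    rw [eval_det_pencil, sum_pow_smul_update, add_sub_cancel_left, smul_smul]
  simp_rw [hrw]
  exact (continuous_const.add ((continuous_const.mul continuous_id).smul continuous_const)).matrix_det

/-- At `c = 0` the perturbed pencil is the original one. -/
theorem det_perturb_zero {K m : ℕ} (d : Fin K → ℕ) (S : Fin K → Matrix (Fin m) (Fin m) ℝ)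
    (l₀ : Fin K) (E : Matrix (Fin m) (Fin m) ℝ) :
    (∑ l, (Polynomial.X : ℝ[X]) ^ d l • (Function.update S l₀ (S l₀ + (0 : ℝ) • E) l).map Polynomial.C) =
      ∑ l, (Polynomial.X : ℝ[X]) ^ d l • (S l).map Polynomial.C := by
  rw [zero_smul, add_zero, Function.update_eq_self]

/-! ## 3. Local splitting at odd-multiplicity roots; the stub from the even-multiplicity local lemma -/

/-- **Local splitting at ODD-multiplicity roots** (both signs, any `E`, any `l₀`): at a positive root `ρ` of odd
multiplicity of `det F_S`, for every `δ > 0` there is `ε₀ > 0` such that for all `0 < ε < ε₀` the determinant of the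
perturbed pencil `S[l₀ ↦ S_{l₀} + (sε) E]` changes sign strictly inside `(ρ - δ, ρ + δ)`. -/
theorem localSplit_of_odd {K m : ℕ} (d : Fin K → ℕ) (S : Fin K → Matrix (Fin m) (Fin m) ℝ)
    (l₀ : Fin K) (E : Matrix (Fin m) (Fin m) ℝ) (s : ℝ) (ρ : ℝ)
    (hp : (∑ l, (Polynomial.X : ℝ[X]) ^ d l • (S l).map Polynomial.C).det ≠ 0)
    (hodd : Odd ((∑ l, (Polynomial.X : ℝ[X]) ^ d l • (S l).map Polynomial.C).det.rootMultiplicity ρ))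
    (δ : ℝ) (hδ : 0 < δ) :
    ∃ ε₀ : ℝ, 0 < ε₀ ∧ ∀ ε : ℝ, 0 < ε → ε < ε₀ → ∃ a b : ℝ, ρ - δ < a ∧ a < b ∧ b < ρ + δ ∧
      (∑ l, (Polynomial.X : ℝ[X]) ^ d l •
          (Function.update S l₀ (S l₀ + (s * ε) • E) l).map Polynomial.C).det.eval a *
        (∑ l, (Polynomial.X : ℝ[X]) ^ d l •
          (Function.update S l₀ (S l₀ + (s * ε) • E) l).map Polynomial.C).det.eval b < 0 := by
  set p := (∑ l, (Polynomial.X : ℝ[X]) ^ d l • (S l).map Polynomial.C).det with hpdef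
  obtain ⟨a, b, ha, haρ, hρb, hb, hsign⟩ := exists_signChange_near_of_odd p hp ρ hodd δ hδ
  -- the family c ↦ det of the perturbed pencil, read at a and b
  set g : ℝ → ℝ → ℝ := fun c t =>
    ((∑ l, (Polynomial.X : ℝ[X]) ^ d l •
      (Function.update S l₀ (S l₀ + c • E) l).map Polynomial.C).det).eval t with hgdef
  have hg0 : ∀ t, g 0 t = p.eval t := fun t => by simp only [hgdef, det_perturb_zero, hpdef]
  have hcont : ∀ t, ContinuousAt (fun c => g c t) 0 := fun t => (continuous_det_perturb d S l₀ E t).continuousAt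
  obtain ⟨ε₀, hε₀, hε⟩ := exists_eps_signChange_of_continuousAt g a b (hcont a) (hcont b)
    (by rw [hg0, hg0]; exact hsign)
  -- |s ε| < ε₀ as soon as ε < ε₀ / (|s| + 1)
  refine ⟨ε₀ / (|s| + 1), div_pos hε₀ (by positivity), fun ε hεpos hεlt => ⟨a, b, ha, haρ.trans hρb, hb, ?_⟩⟩
  have hsmall : |s * ε| < ε₀ := by
    rw [abs_mul, abs_of_pos hεpos]
    have h1 : |s| * ε ≤ (|s| + 1) * ε := by nlinarith [abs_nonneg s]
    have h2 : (|s| + 1) * ε < ε₀ := by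
      have := (lt_div_iff₀ (by positivity : (0 : ℝ) < |s| + 1)).mp hεlt
      linarith
    linarith
  exact hε (s * ε) hsmall

/-- **The stub from the even-multiplicity local lemma.**  Under the hypothesis of `PerturbToAlternation` for the
format `(d, m)` with bound `B`, a symmetric pencil `S` has at most `2B` distinct positive roots PROVIDED every
positive root of EVEN multiplicity of `det F_S` splits locally for the perturbed pencils `S[l₀ ↦ S_{l₀} + (sε) E]`
(`E` symmetric): for one sign `s = ±1` and every `δ > 0`, for all small `ε > 0` the perturbed determinant changes
sign strictly inside `(ρ - δ, ρ + δ)`.  (Odd-multiplicity roots are handled by `localSplit_of_odd`; the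
even-multiplicity local lemma is the residual content of the stub, NOT proved in the tree.) -/
theorem posRootCount_le_of_evenSplit (K m : ℕ) (d : Fin K → ℕ) (B : ℕ)
    (H : ∀ S : Fin K → Matrix (Fin m) (Fin m) ℝ, (∀ l, (S l).IsSymm) →
      ∀ (N : ℕ) (τ : Fin (N + 1) → ℝ),
        (StrictMono τ ∧ (∀ j, 0 < τ j) ∧ ∀ j : Fin N,
          (∑ l, (Polynomial.X : ℝ[X]) ^ d l • (S l).map Polynomial.C).det.eval (τ j.castSucc) *
            (∑ l, (Polynomial.X : ℝ[X]) ^ d l • (S l).map Polynomial.C).det.eval (τ j.succ) < 0) → N ≤ B)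
    (S : Fin K → Matrix (Fin m) (Fin m) ℝ) (hS : ∀ l, (S l).IsSymm)
    (l₀ : Fin K) (E : Matrix (Fin m) (Fin m) ℝ) (hE : E.IsSymm)
    (heven : ∀ ρ ∈ ((∑ l, (Polynomial.X : ℝ[X]) ^ d l • (S l).map Polynomial.C).det.roots.toFinset.filter
        fun ρ => 0 < ρ),
        Even ((∑ l, (Polynomial.X : ℝ[X]) ^ d l • (S l).map Polynomial.C).det.rootMultiplicity ρ) →
        ∃ s : ℝ, (s = 1 ∨ s = -1) ∧ ∀ δ : ℝ, 0 < δ → ∃ ε₀ : ℝ, 0 < ε₀ ∧ ∀ ε : ℝ, 0 < ε → ε < ε₀ →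
          ∃ a b : ℝ, ρ - δ < a ∧ a < b ∧ b < ρ + δ ∧
            (∑ l, (Polynomial.X : ℝ[X]) ^ d l •
                (Function.update S l₀ (S l₀ + (s * ε) • E) l).map Polynomial.C).det.eval a *
              (∑ l, (Polynomial.X : ℝ[X]) ^ d l •
                (Function.update S l₀ (S l₀ + (s * ε) • E) l).map Polynomial.C).det.eval b < 0) :
    ((∑ l, (Polynomial.X : ℝ[X]) ^ d l • (S l).map Polynomial.C).det.roots.toFinset.filter
        fun ρ => 0 < ρ).card ≤ 2 * B := by
  classical
  set p := (∑ l, (Polynomial.X : ℝ[X]) ^ d l • (S l).map Polynomial.C).det with hpdef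
  by_cases hp : p = 0
  · simp [hp]
  refine posRootCount_le_of_localSplit K m d B H S hS l₀ E hE fun ρ hρ => ?_
  rcases Nat.even_or_odd (p.rootMultiplicity ρ) with hev | hodd
  · exact heven ρ hρ hev
  · exact ⟨1, Or.inl rfl, fun δ hδ => localSplit_of_odd d S l₀ E 1 ρ hp hodd δ hδ⟩

end Perturb

end Summit.ValiantsHypothesis.ValiantsHypothesis.Theorems.LacunarySymmetroidMatrixDescartes
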